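import Literature.Analysis.FluidPDE.Tao2016AveragedNS.RenormalisedCascadeWaves

/-!
# Tao 2016, §4: (S)-survival of discretely self-similar blow-up waves, the κ-normal form of
# Theorem 4.2-level blow-up, viscous pseudo-solutions and the dyadic member — LEMMA LAYER

T. Tao, *Finite time blowup for an averaged three-dimensional Navier–Stokes equation*, J. Amer.
Math. Soc. **29** (2016) 601–674 = arXiv:1402.0290v3 [`Tao2016AveragedNS`]: §1.2 (the dyadic
Katz–Pavlović model system `∂ₜXₙ = λ^{n-1}X_{n-1}² − λⁿXₙX_{n+1}`), §3 (the exponent `5/2` and the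
dyadic scale invariance of local cascade operators, remark after Definition 3.1), §4 (the cascade
ODE (4.1)–(4.4), Lemma 4.1 (4.5)–(4.11) with the remark after (4.11) on the dissipation term
`8π²(1+ε₀)^{2n}E_{i,n}`, Theorem 4.2, and the remark before Theorem 4.2 that the viscous system
generalises the dyadic model with `λ = (1+ε₀)^{5/2}`, `α = 2/5`, `m = 1`), §6.4 (renormalising
the dynamics).

This module is the LEMMA LAYER over the definition module `RenormalisedCascadeWaves`
(`sEnergy`, `sMass`, `IsSWave`, `Em`, `qform`, `tableQ`/`tableA`/`tableB`, `fluxConst`, `bigLam`,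
`dssMu`, `wEnergy`, `IsDSSWave`, `Surviving`, `IsEternal`, `physWeight`, `dssEmbed`,
`EternalSurvivingFwd`, `HasGlobal`, `shellShift`, `ViscousGlobal`, `dyadicTable`) and the tree
vocabulary of `LocalCascadeSolutions` (`InTableClass`, `NoGlobalCascade`,
`CascadeODESolutionFrom`).  It was requested by cell harvest/h2-tao-ladder (planner theory-2 g7;
source: the kernel-checked cell file `ThmAB_general_v12.lean`, sha16 0213002eed391f21, Parts 2,
5, 7–11, re-based on the tree) to state the NEGATIVE side of the cell's rung 2 ("no Theorem
4.2-level blow-up on the comparable class E₂(R) below a threshold scale ratio") and its candidate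
cruxes.  Everything here is a PREDICATE WITH PARAMETERS or an IMPLICATION between such
predicates; nothing is asserted about any particular table, and NOTHING in this file is a
statement about the Navier–Stokes equations — MODEL lattice ODEs only.  The closed claims of the
cell (`∀ R ≥ 1, NoSurvivingDSS R 1`, `∀ R ≥ 1, BlowupRigidity R 1`, `∀ R ≥ 1, ViscousStall R`,
`∀ R ≥ 1, NoRobustBlowupBelow R`) are conjectures and therefore ROUTE ITEMS under `Summits/…`,
not declarations of this file.

* Elementary lemmas on `sEnergy`, `sMass`, `fluxConst`, `bigLam`, `dssMu`, `wEnergy`; kinematics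
  of **(S_a)-survival** (`Surviving.mono`, `inv_pow_lt_dssMu`, `one_sub_dssMu_le_of_surviving`,
  `IsDSSWave.surviving_five`: every admissible sub-unitary DSS wave with positive delay is
  (S_5)-surviving — the exponent `a = 5` is vacuous, cf. the cell's withdrawn `EpsGap`).
* The two crux PREDICATES of the cell's negative route: `NoSurvivingDSS R a` (K1(a): below a
  threshold scale ratio no E₂(R) table carries a non-trivial admissible (S_a)-surviving DSS wave)
  and `BlowupRigidity R a` (K2(a): below a threshold, Theorem 4.2-level blow-up of an E₂(R) table
  forces such a wave); the target predicate `NoRobustBlowupBelow R`; the glue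
  `noRobustBlowupBelow_of_noSurviving_of_rigidity : NoSurvivingDSS R a → BlowupRigidity R a →
  NoRobustBlowupBelow R`; monotonicity in `a` and in the spread `R` (`InTableClass.mono`); natural
  spreads; `not_exists_robustBlowup_of_noRobustBlowupBelow` (the target at every `R ≥ 1` negates
  the positive rung-2 shape); KILL CRITERIA (`witness family → ¬ predicate`) for K1, K2 and the
  target.
* Forward (S_a)-survival of **admissible eternal solutions**: `NoSurvivingEternalFwd R a` /
  `EternalRigidityFwd R a` and their glue; every admissible DSS wave is an admissible eternal
  solution (`IsDSSWave.isEternal_dssEmbed`) and a surviving positive delay makes it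
  forward-surviving (`eternalSurvivingFwd_dssEmbed`); hence K1^∞_fwd ⇒ K1
  (`noSurvivingDSS_of_noSurvivingEternalFwd`) and K2 ⇒ K2^∞_fwd
  (`eternalRigidityFwd_of_blowupRigidity`).
* **The κ-normal form of Theorem 4.2-level blow-up**: monotonicity of `CascadeODESolutionFrom` /
  `HasGlobal` in the defect constants, SHELL-SHIFT COVARIANCE (`cascadeFrom_shellShift`: a datum at
  shell `n₀ + d` with defects `(K₁, K₂)` is a datum at shell `n₀` with defects
  `(K₁λ^{-d/2}, K₂λ^{-d/2})`), `noGlobalCascade_iff_kappa : NoGlobalCascade ε₀ α X₀ ↔ ∃ κ > 0,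
  ¬ HasGlobal ε₀ α κ κ 0 X₀` (for `0 < ε₀`), and `noRobustBlowupBelow_iff_stallable`.
* **Viscous pseudo-solutions**: a global regular solution of the NS-scaled viscous lattice
  (`ViscousGlobal ε₀ ν α X₀ X`, dissipation `ν(1+ε₀)^{2n}`) is a `(ν√2, 0)`-pseudo-solution
  (`hasGlobal_of_viscousGlobal`); the predicate `ViscousStall R` (uniform viscous stall) and
  `noRobustBlowupBelow_of_viscousStall`; its kill criterion.
* **The dyadic member of E₂(R)**: `dyadicTable` is symmetric, cancelling and `R`-comparable for
  `R ≥ 2` (`inTableClass_dyadicTable`), and its `quadTerm` is the Katz–Pavlović / Cheskidov chain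
  at base `1+ε₀` on component `0` (`quadTerm_dyadicTable_zero`); every predicate above
  specialises to it (`NoSurvivingDSS.dyadic`, `ViscousStall.dyadic`, `NoRobustBlowupBelow.dyadic`,
  dyadic kill criteria).

The companion module `ViscousDyadicMemberRegularity` (same namespace) transports
Barbato–Morandin–Romito 2011, Thm. 1 (PROVED in the tree) to the viscous dyadic member at
`ε₀ = 1`: there `HasGlobal 1 dyadicTable κ κ 0 X₀` holds for every `κ > 0` and
`¬ NoGlobalCascade 1 dyadicTable X₀` (non-negative one-shell datum on component `0`) — the
non-vacuity witness for the objects of this layer; it says nothing about small `ε₀`.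

No instances, no notation.  Docstrings mark cell vocabulary as such.
-/

noncomputable section

open Set MeasureTheory intervalIntegral Filter Topology

namespace Literature.Analysis.FluidPDE

namespace TaoCascade

/-! ### Profile systems of a finite family of profiles -/

section ProfileSystem

variable {V : Type*} [NormedAddCommGroup V]
variable {ρ : Type*} [Fintype ρ]

/-- [cite: Tao2016AveragedNS, §4; cell vocabulary] -/
theorem sEnergy_nonneg (Φ : ρ → ℝ → V) (x : ℝ) : 0 ≤ sEnergy Φ x :=
  Finset.sum_nonneg fun _ _ => by positivity

/-- [cite: Tao2016AveragedNS, §4; cell vocabulary] -/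
theorem sMass_nonneg (Φ : ρ → ℝ → V) (x : ℝ) : 0 ≤ sMass Φ x :=
  Finset.sum_nonneg fun _ _ => norm_nonneg _

/-- [cite: Tao2016AveragedNS, §4; cell vocabulary] -/
theorem eq_zero_of_sEnergy_eq_zero {Φ : ρ → ℝ → V} {x : ℝ} (h : sEnergy Φ x = 0) (r : ρ) :
    Φ r x = 0 := by
  unfold sEnergy at h
  have h2 : ‖Φ r x‖ ^ 2 = 0 :=
    (Finset.sum_eq_zero_iff_of_nonneg (fun r _ => by positivity)).mp h r (Finset.mem_univ r)
  exact norm_eq_zero.mp ((pow_eq_zero_iff (n := 2) (by norm_num)).mp h2)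

/-- [cite: Tao2016AveragedNS, §4; cell vocabulary] -/
theorem norm_le_sMass (Φ : ρ → ℝ → V) (x : ℝ) (r : ρ) : ‖Φ r x‖ ≤ sMass Φ x :=
  Finset.single_le_sum (f := fun r' => ‖Φ r' x‖) (fun _ _ => norm_nonneg _) (Finset.mem_univ r)

/-- [cite: Tao2016AveragedNS, §4; cell vocabulary] -/
theorem sEnergy_eq_zero {Φ : ρ → ℝ → V} {x : ℝ} (h : ∀ r, Φ r x = 0) : sEnergy Φ x = 0 :=
  Finset.sum_eq_zero fun r _ => by rw [h r, norm_zero, zero_pow two_ne_zero]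

end ProfileSystem

/-! ### The structure maps of a table on Tao's shift set, grouped by monomial type -/

section TableMaps

variable {m : ℕ}

/-- [cite: Tao2016AveragedNS, §4 (4.4); cell vocabulary] -/
theorem fluxConst_nonneg (α : Fin m → Fin m → Fin m → ℤ × ℤ × ℤ → ℝ) : 0 ≤ fluxConst α :=
  Finset.sum_nonneg fun _ _ => Finset.sum_nonneg fun _ _ =>
    Finset.sum_nonneg fun _ _ => abs_nonneg _

end TableMaps

/-! ### Admissible DSS blow-up waves of a table, their energy ratio, (S_a)-survival -/

section DSSWaves

variable {ρ : Type*} [Fintype ρ]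
variable {m : ℕ}

/-- [cite: Tao2016AveragedNS, §6.4; cell vocabulary] -/
theorem wEnergy_nonneg {V : Type*} [NormedAddCommGroup V] (d : ℝ) (Φ : ρ → ℝ → V) (x : ℝ) :
    0 ≤ wEnergy d Φ x :=
  mul_nonneg (Real.exp_pos _).le (Finset.sum_nonneg fun _ _ => by positivity)

/-- `Surviving a` gets weaker as `a` grows. [cite: Tao2016AveragedNS, §4; cell vocabulary] -/
theorem Surviving.mono {a a' ε₀ T : ℝ} (hε : 0 ≤ ε₀) (h : Surviving a ε₀ T) (haa : a ≤ a') :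
    Surviving a' ε₀ T :=
  ⟨(Real.rpow_le_rpow_of_exponent_le (by linarith) (neg_le_neg haa)).trans h.1, h.2⟩

/-- A positive delay caps the residue fraction: `(1+ε₀)^{-5} < μ`.
[cite: Tao2016AveragedNS, §4; cell vocabulary] -/
theorem inv_pow_lt_dssMu {ε₀ T : ℝ} (hε : 0 < ε₀) (hT : 0 < T) :
    ((1 + ε₀) ^ 5)⁻¹ < dssMu ε₀ T := by
  unfold dssMu
  rw [inv_eq_one_div]
  exact div_lt_div_of_pos_right (Real.one_lt_exp_iff.2 (by linarith)) (by positivity)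

/-- Survival with exponent `a ≥ 0` caps the residue fraction by `aε₀`: `1 - μ ≤ aε₀`.
[cite: Tao2016AveragedNS, §4; cell vocabulary] -/
theorem one_sub_dssMu_le_of_surviving {a ε₀ T : ℝ} (hε : 0 < ε₀) (ha : 0 ≤ a)
    (hS : Surviving a ε₀ T) : 1 - dssMu ε₀ T ≤ a * ε₀ := by
  have hb : 0 < 1 + ε₀ := by linarith
  have h1 : (1 + ε₀) ^ (-a) = Real.exp (Real.log (1 + ε₀) * (-a)) := Real.rpow_def_of_pos hb _
  have h2 : 1 + Real.log (1 + ε₀) * (-a) ≤ (1 + ε₀) ^ (-a) := by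
    rw [h1]; linarith [Real.add_one_le_exp (Real.log (1 + ε₀) * (-a))]
  have h3 : Real.log (1 + ε₀) ≤ ε₀ := by linarith [Real.log_le_sub_one_of_pos hb]
  have h4 : Real.log (1 + ε₀) * a ≤ ε₀ * a := mul_le_mul_of_nonneg_right h3 ha
  linarith [hS.1]

/-- [cite: Tao2016AveragedNS, §4; cell vocabulary] -/
theorem rpow_neg_five_eq_inv_pow {ε₀ : ℝ} (hε : 0 ≤ ε₀) :
    (1 + ε₀) ^ (-(5 : ℝ)) = ((1 + ε₀) ^ 5)⁻¹ := by
  rw [Real.rpow_neg (by linarith), show (5 : ℝ) = ((5 : ℕ) : ℝ) by norm_num, Real.rpow_natCast]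

/-- Every admissible sub-unitary DSS wave is (S₅)-surviving (delay kinematics): the family
`Surviving a`, `a ≥ 5`, is constant. [cite: Tao2016AveragedNS, §4; cell vocabulary] -/
theorem IsDSSWave.surviving_five {ε₀ : ℝ} {α : Fin m → Fin m → Fin m → ℤ × ℤ × ℤ → ℝ}
    {π : Equiv.Perm ρ} {T : ℝ} {Φ : ρ → ℝ → Em m} (h : IsDSSWave ε₀ α π T Φ) (hε : 0 < ε₀)
    (hμ : dssMu ε₀ T < 1) : Surviving 5 ε₀ T :=
  ⟨by rw [rpow_neg_five_eq_inv_pow hε.le]; exact (inv_pow_lt_dssMu hε h.delay_pos).le, hμ⟩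

end DSSWaves

/-! ### The crux predicates K1 = `NoSurvivingDSS`, K2 = `BlowupRigidity`, the target predicate
`NoRobustBlowupBelow`, and the glue `K1 ∧ K2 ⇒ NoRobustBlowupBelow` -/

section Cruxes

/-- **K1 = `NoSurvivingDSS R a`.**  Below a threshold `ε_*(R, a) > 0`, NO table of the class
E₂(R) (`m = 4`) carries a non-trivial admissible DSS wave (any period `q`, shape permutation
`π`, delay `T`) that is (S_a)-surviving.  A predicate on `(R, a)` (antitone in both); nothing is
asserted. [cite: Tao2016AveragedNS, §4 Thm. 4.2 (statement shape), §6.4; cell vocabulary] -/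
def NoSurvivingDSS (R a : ℝ) : Prop :=
  ∃ εs : ℝ, 0 < εs ∧ ∀ ε₀ : ℝ, 0 < ε₀ → ε₀ ≤ εs →
    ∀ α : Fin 4 → Fin 4 → Fin 4 → ℤ × ℤ × ℤ → ℝ, InTableClass R α →
      ∀ (q : ℕ) (π : Equiv.Perm (Fin q)) (T : ℝ) (Φ : Fin q → ℝ → Em 4),
        IsDSSWave ε₀ α π T Φ → Surviving a ε₀ T → ∀ r x, Φ r x = 0

/-- **K2 = `BlowupRigidity R a` (Liouville type).**  Below a threshold, Theorem 4.2-level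
(defect-tolerant) blow-up of an E₂(R) table from a one-shell datum forces the existence of a
non-trivial admissible (S_a)-surviving DSS wave on that table.  A predicate on `(R, a)` (antitone
in `R`, monotone in `a`); nothing is asserted.
[cite: Tao2016AveragedNS, §4 Thm. 4.2 (statement shape), §6.4; cell vocabulary] -/
def BlowupRigidity (R a : ℝ) : Prop :=
  ∃ εs : ℝ, 0 < εs ∧ ∀ ε₀ : ℝ, 0 < ε₀ → ε₀ ≤ εs →
    ∀ (α : Fin 4 → Fin 4 → Fin 4 → ℤ × ℤ × ℤ → ℝ) (X₀ : Fin 4 → ℝ), InTableClass R α →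
      NoGlobalCascade ε₀ α X₀ →
        ∃ (q : ℕ) (π : Equiv.Perm (Fin q)) (T : ℝ) (Φ : Fin q → ℝ → Em 4),
          IsDSSWave ε₀ α π T Φ ∧ Surviving a ε₀ T ∧ ∃ r x, Φ r x ≠ 0

/-- **No Theorem 4.2-level blow-up on E₂(R) below a threshold** (the cell's "BP-D-latt at spread
`R`"): there is `ε_R > 0` such that for every scale ratio `1+ε₀`, `ε₀ ∈ (0, ε_R]`, no
`R`-comparable symmetric cancelling four-mode table blows up at Theorem 4.2 level from any
one-shell datum.  A predicate on `R` (antitone); nothing is asserted.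
[cite: Tao2016AveragedNS, §4 Thm. 4.2 (statement shape); cell vocabulary] -/
def NoRobustBlowupBelow (R : ℝ) : Prop :=
  ∃ εR : ℝ, 0 < εR ∧ ∀ ε₀ : ℝ, 0 < ε₀ → ε₀ ≤ εR →
    ∀ (α : Fin 4 → Fin 4 → Fin 4 → ℤ × ℤ × ℤ → ℝ) (X₀ : Fin 4 → ℝ), InTableClass R α →
      ¬ NoGlobalCascade ε₀ α X₀

/-- **GLUE: `K1 ∧ K2 ⇒ NoRobustBlowupBelow`** at one spread and one exponent.
[cite: Tao2016AveragedNS, §4 Thm. 4.2; cell vocabulary] -/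
theorem noRobustBlowupBelow_of_noSurviving_of_rigidity {R a : ℝ}
    (h1 : NoSurvivingDSS R a) (h2 : BlowupRigidity R a) : NoRobustBlowupBelow R := by
  obtain ⟨ε₁, hε₁, H1⟩ := h1
  obtain ⟨ε₂, hε₂, H2⟩ := h2
  refine ⟨min ε₁ ε₂, lt_min hε₁ hε₂, fun ε₀ hε₀ hle α X₀ hα hNG => ?_⟩
  obtain ⟨q, π, T, Φ, hW, hS, r, x, hne⟩ :=
    H2 ε₀ hε₀ (hle.trans (min_le_right _ _)) α X₀ hα hNG
  exact hne (H1 ε₀ hε₀ (hle.trans (min_le_left _ _)) α hα q π T Φ hW hS r x)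

/-- K1 is antitone in `a`. [cite: Tao2016AveragedNS, §4; cell vocabulary] -/
theorem NoSurvivingDSS.of_le {R a a' : ℝ} (h : NoSurvivingDSS R a') (haa : a ≤ a') :
    NoSurvivingDSS R a := by
  obtain ⟨εs, hεs, H⟩ := h
  exact ⟨εs, hεs, fun ε₀ hε₀ hle α hα q π T Φ hW hS =>
    H ε₀ hε₀ hle α hα q π T Φ hW (hS.mono hε₀.le haa)⟩

/-- K2 is monotone in `a`. [cite: Tao2016AveragedNS, §4; cell vocabulary] -/
theorem BlowupRigidity.mono {R a a' : ℝ} (h : BlowupRigidity R a) (haa : a ≤ a') :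
    BlowupRigidity R a' := by
  obtain ⟨εs, hεs, H⟩ := h
  refine ⟨εs, hεs, fun ε₀ hε₀ hle α X₀ hα hNG => ?_⟩
  obtain ⟨q, π, T, Φ, hW, hS, hne⟩ := H ε₀ hε₀ hle α X₀ hα hNG
  exact ⟨q, π, T, Φ, hW, hS.mono hε₀.le haa, hne⟩

/-- **Mixed-exponent glue**: K1 at `a₁` and K2 at `a₂ ≤ a₁` give `NoRobustBlowupBelow`.
[cite: Tao2016AveragedNS, §4 Thm. 4.2; cell vocabulary] -/
theorem noRobustBlowupBelow_of_exponents {R a₁ a₂ : ℝ} (h : a₂ ≤ a₁)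
    (h1 : NoSurvivingDSS R a₁) (h2 : BlowupRigidity R a₂) : NoRobustBlowupBelow R :=
  noRobustBlowupBelow_of_noSurviving_of_rigidity h1 (h2.mono h)

/-- `NoRobustBlowupBelow` at every spread `R ≥ 1` refutes "Theorem 4.2-level blow-up somewhere on
the comparable class at all small scale ratios" (the shape of the cell's positive rung-2 target).
[cite: Tao2016AveragedNS, §4 Thm. 4.2 (statement shape); cell vocabulary] -/
theorem not_exists_robustBlowup_of_noRobustBlowupBelow
    (h : ∀ R : ℝ, 1 ≤ R → NoRobustBlowupBelow R) :
    ¬ ∃ R : ℝ, 1 ≤ R ∧ ∃ εs : ℝ, 0 < εs ∧ εs < 1 ∧ ∀ ε₀ : ℝ, 0 < ε₀ → ε₀ ≤ εs →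
      ∃ (α : Fin 4 → Fin 4 → Fin 4 → ℤ × ℤ × ℤ → ℝ) (X₀ : Fin 4 → ℝ),
        InTableClass R α ∧ NoGlobalCascade ε₀ α X₀ := by
  rintro ⟨R, hR, εs, hεs, -, H⟩
  obtain ⟨εR, hεR, H'⟩ := h R hR
  obtain ⟨α, X₀, hα, hNG⟩ := H (min εs εR) (lt_min hεs hεR) (min_le_left _ _)
  exact H' (min εs εR) (lt_min hεs hεR) (min_le_right _ _) α X₀ hα hNG

end Cruxes

/-! ### Admissible eternal solutions of the renormalised lattice and FORWARD (S_a)-survival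

The log-time `σ` of a survival witness is tied to the shell threshold (`N ≤ σ`), so that only
forward-time survival counts (cell referee, cycle 16 (2)(b)). -/

section EternalSolutions

variable {ρ : Type*} [Fintype ρ]
variable {m : ℕ}

/-- [cite: Tao2016AveragedNS, §4; cell vocabulary] -/
theorem physWeight_nonneg {a ε₀ : ℝ} (hε : 0 ≤ ε₀) : 0 ≤ physWeight a ε₀ := by
  unfold physWeight; positivity

/-- [cite: Tao2016AveragedNS, §4; cell vocabulary] -/
theorem physWeight_mono {a a' ε₀ : ℝ} (hε : 0 ≤ ε₀) (haa : a ≤ a') :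
    physWeight a ε₀ ≤ physWeight a' ε₀ := by
  unfold physWeight
  exact div_le_div_of_nonneg_right (Real.rpow_le_rpow_of_exponent_le (by linarith) haa)
    (by positivity)

/-- Forward survival gets weaker as `a` grows. [cite: Tao2016AveragedNS, §4; cell vocabulary] -/
theorem EternalSurvivingFwd.mono {a a' ε₀ : ℝ} {W : ℤ → ℝ → Em m} (hε : 0 ≤ ε₀)
    (h : EternalSurvivingFwd a ε₀ W) (haa : a ≤ a') : EternalSurvivingFwd a' ε₀ W := by
  obtain ⟨c, hc, H⟩ := h
  refine ⟨c, hc, fun N => ?_⟩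
  obtain ⟨n, hn, σ, hσN, hσ⟩ := H N
  exact ⟨n, hn, σ, hσN, hσ.trans (mul_le_mul_of_nonneg_right
    (pow_le_pow_left₀ (physWeight_nonneg hε) (physWeight_mono hε haa) n) (by positivity))⟩

/-- **K1^∞_fwd = `NoSurvivingEternalFwd R a`.**  Below a threshold, no E₂(R) table (`m = 4`)
carries an admissible eternal solution of its renormalised lattice that is (S_a)-surviving
forward in log-time.  Stronger than K1 (`noSurvivingDSS_of_noSurvivingEternalFwd`).  A predicate;
nothing is asserted. [cite: Tao2016AveragedNS, §4 Thm. 4.2 (statement shape), §6.4; cell vocabulary] -/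
def NoSurvivingEternalFwd (R a : ℝ) : Prop :=
  ∃ εs : ℝ, 0 < εs ∧ ∀ ε₀ : ℝ, 0 < ε₀ → ε₀ ≤ εs →
    ∀ α : Fin 4 → Fin 4 → Fin 4 → ℤ × ℤ × ℤ → ℝ, InTableClass R α →
      ∀ W : ℤ → ℝ → Em 4, IsEternal ε₀ α W → ¬ EternalSurvivingFwd a ε₀ W

/-- **K2^∞_fwd = `EternalRigidityFwd R a`.**  Below a threshold, Theorem 4.2-level blow-up of an
E₂(R) table from a one-shell datum forces an admissible eternal solution surviving forward in
log-time.  Weaker than K2 (`eternalRigidityFwd_of_blowupRigidity`).  A predicate; nothing is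
asserted. [cite: Tao2016AveragedNS, §4 Thm. 4.2 (statement shape), §6.4; cell vocabulary] -/
def EternalRigidityFwd (R a : ℝ) : Prop :=
  ∃ εs : ℝ, 0 < εs ∧ ∀ ε₀ : ℝ, 0 < ε₀ → ε₀ ≤ εs →
    ∀ (α : Fin 4 → Fin 4 → Fin 4 → ℤ × ℤ × ℤ → ℝ) (X₀ : Fin 4 → ℝ), InTableClass R α →
      NoGlobalCascade ε₀ α X₀ →
        ∃ W : ℤ → ℝ → Em 4, IsEternal ε₀ α W ∧ EternalSurvivingFwd a ε₀ W

/-- **GLUE: `K1^∞_fwd ∧ K2^∞_fwd ⇒ NoRobustBlowupBelow`** (one spread, one exponent).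
[cite: Tao2016AveragedNS, §4 Thm. 4.2; cell vocabulary] -/
theorem noRobustBlowupBelow_of_eternalFwd {R a : ℝ}
    (h1 : NoSurvivingEternalFwd R a) (h2 : EternalRigidityFwd R a) : NoRobustBlowupBelow R := by
  obtain ⟨ε₁, hε₁, H1⟩ := h1
  obtain ⟨ε₂, hε₂, H2⟩ := h2
  refine ⟨min ε₁ ε₂, lt_min hε₁ hε₂, fun ε₀ hε₀ hle α X₀ hα hNG => ?_⟩
  obtain ⟨W, hW, hS⟩ := H2 ε₀ hε₀ (hle.trans (min_le_right _ _)) α X₀ hα hNG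
  exact H1 ε₀ hε₀ (hle.trans (min_le_left _ _)) α hα W hW hS

/-- K1^∞_fwd is antitone in `a`. [cite: Tao2016AveragedNS, §4; cell vocabulary] -/
theorem NoSurvivingEternalFwd.of_le {R a a' : ℝ} (h : NoSurvivingEternalFwd R a') (haa : a ≤ a') :
    NoSurvivingEternalFwd R a := by
  obtain ⟨εs, hεs, H⟩ := h
  exact ⟨εs, hεs, fun ε₀ hε₀ hle α hα W hW hS => H ε₀ hε₀ hle α hα W hW (hS.mono hε₀.le haa)⟩

/-- K2^∞_fwd is monotone in `a`. [cite: Tao2016AveragedNS, §4; cell vocabulary] -/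
theorem EternalRigidityFwd.mono {R a a' : ℝ} (h : EternalRigidityFwd R a) (haa : a ≤ a') :
    EternalRigidityFwd R a' := by
  obtain ⟨εs, hεs, H⟩ := h
  refine ⟨εs, hεs, fun ε₀ hε₀ hle α X₀ hα hNG => ?_⟩
  obtain ⟨W, hW, hS⟩ := H ε₀ hε₀ hle α X₀ hα hNG
  exact ⟨W, hW, hS.mono hε₀.le haa⟩

/-! #### The DSS embedding: every admissible DSS wave is an admissible eternal solution -/

omit [Fintype ρ] in
/-- [cite: Tao2016AveragedNS, §4; auxiliary] -/
theorem perm_apply_zpow_apply (π : Equiv.Perm ρ) (n : ℤ) (r : ρ) :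
    π ((π ^ n) r) = (π ^ (n + 1)) r := by
  rw [← mul_self_zpow, Equiv.Perm.mul_apply]

omit [Fintype ρ] in
/-- [cite: Tao2016AveragedNS, §4; auxiliary] -/
theorem perm_symm_zpow_apply (π : Equiv.Perm ρ) (n : ℤ) (r : ρ) :
    π.symm ((π ^ n) r) = (π ^ (n - 1)) r := by
  apply π.injective
  rw [Equiv.apply_symm_apply, perm_apply_zpow_apply, sub_add_cancel]

omit [Fintype ρ] in
/-- Orbit return: `π^(N·|π|) r = r`. [cite: Tao2016AveragedNS, §4; auxiliary] -/
theorem perm_zpow_mul_orderOf_apply (π : Equiv.Perm ρ) (N : ℕ) (r : ρ) :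
    (π ^ ((N * orderOf π : ℕ) : ℤ)) r = r := by
  rw [zpow_natCast, mul_comm, pow_mul, pow_orderOf_eq_one, one_pow]; rfl

/-- **Every admissible DSS wave is an admissible eternal solution** (shell-wise rewriting of the
profile system; action bound `∫ Σ_r‖Φ_r‖`; half-line bound `e^{2nT}·P`).
[cite: Tao2016AveragedNS, §4 (4.1)–(4.4), §6.4; cell vocabulary] -/
theorem IsDSSWave.isEternal_dssEmbed {ε₀ : ℝ} {α : Fin m → Fin m → Fin m → ℤ × ℤ × ℤ → ℝ}
    {π : Equiv.Perm ρ} {T : ℝ} {Φ : ρ → ℝ → Em m} (h : IsDSSWave ε₀ α π T Φ) (r₀ : ρ) :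
    IsEternal ε₀ α (dssEmbed π T Φ r₀) := by
  refine ⟨fun n σ => ?_, ?_, fun n => ?_⟩
  · -- the lattice law of shell n = the profile equation of profile π^n r₀ at phase σ - nT
    have hw := (h.wave ((π ^ n) r₀) (σ - n * T)).comp_sub_const σ (n * T)
    have e1 : Φ (π.symm ((π ^ n) r₀)) (σ - n * T + T) = dssEmbed π T Φ r₀ (n - 1) σ := by
      simp only [dssEmbed, perm_symm_zpow_apply, Int.cast_sub, Int.cast_one]; ring_nf
    have e2 : Φ (π ((π ^ n) r₀)) (σ - n * T - T) = dssEmbed π T Φ r₀ (n + 1) σ := by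
      simp only [dssEmbed, perm_apply_zpow_apply, Int.cast_add, Int.cast_one]; ring_nf
    rw [e1, e2] at hw
    exact hw
  · -- uniform action bound
    refine ⟨∫ σ, sMass Φ σ, fun n => ?_⟩
    have hcont : Continuous (Φ ((π ^ n) r₀)) :=
      continuous_iff_continuousAt.2 fun x => (h.wave ((π ^ n) r₀) x).continuousAt
    have hmeas : AEStronglyMeasurable (fun σ => ‖dssEmbed π T Φ r₀ n σ‖) volume := by
      have : Continuous fun σ => ‖dssEmbed π T Φ r₀ n σ‖ :=
        (hcont.comp (continuous_id.sub continuous_const)).norm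
      exact this.aestronglyMeasurable
    have hdom : Integrable (fun σ => sMass Φ (σ - n * T)) := h.mass.comp_sub_right (n * T)
    have hint : Integrable (fun σ => ‖dssEmbed π T Φ r₀ n σ‖) := by
      refine hdom.mono' hmeas (Filter.Eventually.of_forall fun σ => ?_)
      rw [norm_norm]
      exact norm_le_sMass Φ _ _
    refine ⟨hint, ?_⟩
    calc ∫ σ, ‖dssEmbed π T Φ r₀ n σ‖ ≤ ∫ σ, sMass Φ (σ - n * T) :=
          integral_mono hint hdom fun σ => norm_le_sMass Φ _ _
      _ = ∫ σ, sMass Φ σ := integral_sub_right_eq_self (fun σ => sMass Φ σ) (n * T)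
  · -- renormalised energy of shell n bounded on a right half-line
    obtain ⟨x₀, P, hP⟩ := h.bdd
    refine ⟨x₀ + n * T, Real.exp (2 * (n * T)) * P, fun σ hσ => ?_⟩
    have hx : x₀ ≤ σ - n * T := by linarith
    have h1 : ‖Φ ((π ^ n) r₀) (σ - n * T)‖ ^ 2 ≤ sEnergy Φ (σ - n * T) :=
      Finset.single_le_sum (f := fun r => ‖Φ r (σ - n * T)‖ ^ 2) (fun _ _ => sq_nonneg _)
        (Finset.mem_univ _)
    have h2 := hP (σ - n * T) hx
    unfold wEnergy at h2
    have hexp : Real.exp (2 * σ) = Real.exp (2 * (n * T)) * Real.exp (2 * 1 * (σ - n * T)) := by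
      rw [← Real.exp_add]; ring_nf
    calc Real.exp (2 * σ) * ‖dssEmbed π T Φ r₀ n σ‖ ^ 2
        = Real.exp (2 * (n * T)) * (Real.exp (2 * 1 * (σ - n * T))
            * ‖Φ ((π ^ n) r₀) (σ - n * T)‖ ^ 2) := by rw [hexp]; simp only [dssEmbed]; ring
      _ ≤ Real.exp (2 * (n * T)) * (Real.exp (2 * 1 * (σ - n * T)) * sEnergy Φ (σ - n * T)) :=
          mul_le_mul_of_nonneg_left (mul_le_mul_of_nonneg_left h1 (Real.exp_pos _).le)
            (Real.exp_pos _).le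
      _ ≤ Real.exp (2 * (n * T)) * P := mul_le_mul_of_nonneg_left h2 (Real.exp_pos _).le

/-- **A surviving positive delay makes the embedding of a non-trivial profile family
forward-(S_a)-surviving**: along the shells `n = N'·|π|` with `N' ≥ N` and `N'T + x₀ ≥ N`, the
embedded family revisits the profile `r₀` at log-time `nT + x₀ ≥ N` with the weighted energy
multiplied by `((1+ε₀)^a μ)^n ≥ 1`. [cite: Tao2016AveragedNS, §4, §6.4; cell vocabulary] -/
theorem eternalSurvivingFwd_dssEmbed {ε₀ a : ℝ} {π : Equiv.Perm ρ} {T : ℝ} {Φ : ρ → ℝ → Em m}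
    (hε : 0 < ε₀) (hT : 0 < T) (hS : Surviving a ε₀ T) {r₀ : ρ} {x₀ : ℝ}
    (hne : Φ r₀ x₀ ≠ 0) : EternalSurvivingFwd a ε₀ (dssEmbed π T Φ r₀) := by
  classical
  have hb : 0 < 1 + ε₀ := by linarith
  -- the survival factor per shell: physWeight · e^{2T} = (1+ε₀)^a · μ ≥ 1
  have hq : 1 ≤ physWeight a ε₀ * Real.exp (2 * T) := by
    have hμ := hS.1
    have hpos : 0 < (1 + ε₀) ^ a := Real.rpow_pos_of_pos hb a
    have hneg : (1 + ε₀) ^ (-a) = ((1 + ε₀) ^ a)⁻¹ := Real.rpow_neg hb.le a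
    have : 1 ≤ (1 + ε₀) ^ a * dssMu ε₀ T := by
      rw [hneg] at hμ
      have := mul_le_mul_of_nonneg_left hμ hpos.le
      rwa [mul_inv_cancel₀ hpos.ne'] at this
    calc (1 : ℝ) ≤ (1 + ε₀) ^ a * dssMu ε₀ T := this
      _ = physWeight a ε₀ * Real.exp (2 * T) := by unfold dssMu physWeight; ring
  refine ⟨Real.exp (2 * x₀) * ‖Φ r₀ x₀‖ ^ 2, ?_, fun N => ?_⟩
  · exact mul_pos (Real.exp_pos _) (by positivity)
  -- push the revisit index forward until the log-time `kT + x₀` passes `N`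
  obtain ⟨M, hM⟩ : ∃ M : ℕ, ((N : ℝ) - x₀) / T ≤ M := exists_nat_ge _
  refine ⟨max N M * orderOf π, ?_, (max N M * orderOf π : ℕ) * T + x₀, ?_, ?_⟩
  · exact (le_max_left N M).trans (Nat.le_mul_of_pos_right _ (orderOf_pos π))
  · have h1 : ((max N M : ℕ) : ℝ) ≤ ((max N M * orderOf π : ℕ) : ℝ) := by
      exact_mod_cast Nat.le_mul_of_pos_right _ (orderOf_pos π)
    have h2 : (M : ℝ) ≤ ((max N M : ℕ) : ℝ) := by exact_mod_cast le_max_right N M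
    have h3 : ((N : ℝ) - x₀) / T ≤ ((max N M : ℕ) : ℝ) := hM.trans h2
    have h4 : (N : ℝ) - x₀ ≤ ((max N M : ℕ) : ℝ) * T := by rwa [div_le_iff₀ hT] at h3
    have h5 : ((max N M : ℕ) : ℝ) * T ≤ ((max N M * orderOf π : ℕ) : ℝ) * T :=
      mul_le_mul_of_nonneg_right h1 hT.le
    linarith
  have hret : dssEmbed π T Φ r₀ ((max N M * orderOf π : ℕ) : ℤ)
      ((max N M * orderOf π : ℕ) * T + x₀) = Φ r₀ x₀ := by
    simp only [dssEmbed, perm_zpow_mul_orderOf_apply, Int.cast_natCast]; ring_nf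
  rw [hret]
  set k : ℕ := max N M * orderOf π with hk
  have hexp : Real.exp (2 * ((k : ℝ) * T + x₀)) = Real.exp (2 * T) ^ k * Real.exp (2 * x₀) := by
    rw [← Real.exp_nat_mul, ← Real.exp_add]; ring_nf
  rw [hexp]
  have hw : 0 ≤ physWeight a ε₀ := by unfold physWeight; positivity
  calc Real.exp (2 * x₀) * ‖Φ r₀ x₀‖ ^ 2
      = 1 * (Real.exp (2 * x₀) * ‖Φ r₀ x₀‖ ^ 2) := (one_mul _).symm
    _ ≤ (physWeight a ε₀ * Real.exp (2 * T)) ^ k * (Real.exp (2 * x₀) * ‖Φ r₀ x₀‖ ^ 2) :=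
        mul_le_mul_of_nonneg_right (one_le_pow₀ hq) (by positivity)
    _ = physWeight a ε₀ ^ k * (Real.exp (2 * T) ^ k * Real.exp (2 * x₀) * ‖Φ r₀ x₀‖ ^ 2) := by
        rw [mul_pow]; ring

/-- **K1^∞_fwd ⇒ K1.** [cite: Tao2016AveragedNS, §4 Thm. 4.2 (statement shape); cell vocabulary] -/
theorem noSurvivingDSS_of_noSurvivingEternalFwd {R a : ℝ} (h : NoSurvivingEternalFwd R a) :
    NoSurvivingDSS R a := by
  obtain ⟨εs, hεs, H⟩ := h
  refine ⟨εs, hεs, fun ε₀ hε₀ hle α hα q π T Φ hW hS r x => ?_⟩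
  by_contra hne
  exact H ε₀ hε₀ hle α hα (dssEmbed π T Φ r) (hW.isEternal_dssEmbed r)
    (eternalSurvivingFwd_dssEmbed hε₀ hW.delay_pos hS hne)

/-- **K2 ⇒ K2^∞_fwd.** [cite: Tao2016AveragedNS, §4 Thm. 4.2 (statement shape); cell vocabulary] -/
theorem eternalRigidityFwd_of_blowupRigidity {R a : ℝ} (h : BlowupRigidity R a) :
    EternalRigidityFwd R a := by
  obtain ⟨εs, hεs, H⟩ := h
  refine ⟨εs, hεs, fun ε₀ hε₀ hle α X₀ hα hNG => ?_⟩
  obtain ⟨q, π, T, Φ, hW, hS, r, x, hne⟩ := H ε₀ hε₀ hle α X₀ hα hNG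
  exact ⟨dssEmbed π T Φ r, hW.isEternal_dssEmbed r,
    eternalSurvivingFwd_dssEmbed hε₀ hW.delay_pos hS hne⟩

/-- The mixed glue **K1^∞_fwd ∧ K2 ⇒ NoRobustBlowupBelow**.
[cite: Tao2016AveragedNS, §4 Thm. 4.2; cell vocabulary] -/
theorem noRobustBlowupBelow_of_noSurvivingEternalFwd_of_rigidity {R a : ℝ}
    (h1 : NoSurvivingEternalFwd R a) (h2 : BlowupRigidity R a) : NoRobustBlowupBelow R :=
  noRobustBlowupBelow_of_eternalFwd h1 (eternalRigidityFwd_of_blowupRigidity h2)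

end EternalSolutions

/-! ### Monotonicity in the spread `R` and kill criteria -/

section SpreadAndKill

variable {m : ℕ}

/-- E₂(R) grows with `R`. [cite: Tao2016AveragedNS, §6.1; cell vocabulary] -/
theorem InTableClass.mono {R R' : ℝ} {α : Fin m → Fin m → Fin m → ℤ × ℤ × ℤ → ℝ}
    (h : InTableClass R α) (hR : 0 < R) (hRR' : R ≤ R') : InTableClass R' α :=
  ⟨h.1, h.2.1, h.2.2.mono hR hRR'⟩

/-- K1 is antitone in `R`. [cite: Tao2016AveragedNS, §6.1; cell vocabulary] -/
theorem NoSurvivingDSS.of_le_spread {R R' a : ℝ} (hR : 0 < R) (hRR' : R ≤ R')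
    (h : NoSurvivingDSS R' a) : NoSurvivingDSS R a := by
  obtain ⟨εs, hεs, H⟩ := h
  exact ⟨εs, hεs, fun ε₀ hε₀ hle α hα => H ε₀ hε₀ hle α (hα.mono hR hRR')⟩

/-- K2 is antitone in `R`. [cite: Tao2016AveragedNS, §6.1; cell vocabulary] -/
theorem BlowupRigidity.of_le_spread {R R' a : ℝ} (hR : 0 < R) (hRR' : R ≤ R')
    (h : BlowupRigidity R' a) : BlowupRigidity R a := by
  obtain ⟨εs, hεs, H⟩ := h
  exact ⟨εs, hεs, fun ε₀ hε₀ hle α X₀ hα hNG => H ε₀ hε₀ hle α X₀ (hα.mono hR hRR') hNG⟩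

/-- K1^∞_fwd is antitone in `R`. [cite: Tao2016AveragedNS, §6.1; cell vocabulary] -/
theorem NoSurvivingEternalFwd.of_le_spread {R R' a : ℝ} (hR : 0 < R) (hRR' : R ≤ R')
    (h : NoSurvivingEternalFwd R' a) : NoSurvivingEternalFwd R a := by
  obtain ⟨εs, hεs, H⟩ := h
  exact ⟨εs, hεs, fun ε₀ hε₀ hle α hα => H ε₀ hε₀ hle α (hα.mono hR hRR')⟩

/-- K2^∞_fwd is antitone in `R`. [cite: Tao2016AveragedNS, §6.1; cell vocabulary] -/
theorem EternalRigidityFwd.of_le_spread {R R' a : ℝ} (hR : 0 < R) (hRR' : R ≤ R')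
    (h : EternalRigidityFwd R' a) : EternalRigidityFwd R a := by
  obtain ⟨εs, hεs, H⟩ := h
  exact ⟨εs, hεs, fun ε₀ hε₀ hle α X₀ hα hNG => H ε₀ hε₀ hle α X₀ (hα.mono hR hRR') hNG⟩

/-- The target predicate is antitone in `R`. [cite: Tao2016AveragedNS, §6.1; cell vocabulary] -/
theorem NoRobustBlowupBelow.of_le_spread {R R' : ℝ} (hR : 0 < R) (hRR' : R ≤ R')
    (h : NoRobustBlowupBelow R') : NoRobustBlowupBelow R := by
  obtain ⟨εR, hεR, H⟩ := h
  exact ⟨εR, hεR, fun ε₀ hε₀ hle α X₀ hα => H ε₀ hε₀ hle α X₀ (hα.mono hR hRR')⟩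

/-- It suffices to decide the target along the cofinal set of integer spreads.
[cite: Tao2016AveragedNS, §6.1; cell vocabulary] -/
theorem noRobustBlowupBelow_of_nat_spreads (h : ∀ N : ℕ, NoRobustBlowupBelow (N : ℝ)) {R : ℝ}
    (hR : 0 < R) : NoRobustBlowupBelow R := by
  obtain ⟨N, hN⟩ := exists_nat_ge R
  exact (h N).of_le_spread hR hN

/-- Glue from integer spreads: K1 and K2 along `R ∈ ℕ` give the target at every positive spread.
[cite: Tao2016AveragedNS, §4 Thm. 4.2; cell vocabulary] -/
theorem noRobustBlowupBelow_of_nat_spreads_of_cruxes {a : ℝ}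
    (h1 : ∀ N : ℕ, NoSurvivingDSS (N : ℝ) a) (h2 : ∀ N : ℕ, BlowupRigidity (N : ℝ) a) {R : ℝ}
    (hR : 0 < R) : NoRobustBlowupBelow R :=
  noRobustBlowupBelow_of_nat_spreads
    (fun N => noRobustBlowupBelow_of_noSurviving_of_rigidity (h1 N) (h2 N)) hR

/-- **Kill criterion for K1(a):** (S_a)-surviving admissible non-trivial DSS waves on E₂(R)
tables at arbitrarily small scale ratios refute `NoSurvivingDSS R a`.
[cite: Tao2016AveragedNS, §4; cell vocabulary] -/
theorem not_noSurvivingDSS_of_persistent_waves {R a : ℝ}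
    (h : ∀ ε : ℝ, 0 < ε → ∃ ε₀ : ℝ, 0 < ε₀ ∧ ε₀ ≤ ε ∧
      ∃ α : Fin 4 → Fin 4 → Fin 4 → ℤ × ℤ × ℤ → ℝ, InTableClass R α ∧
        ∃ (q : ℕ) (π : Equiv.Perm (Fin q)) (T : ℝ) (Φ : Fin q → ℝ → Em 4),
          IsDSSWave ε₀ α π T Φ ∧ Surviving a ε₀ T ∧ ∃ r x, Φ r x ≠ 0) :
    ¬ NoSurvivingDSS R a := by
  rintro ⟨εs, hεs, H⟩
  obtain ⟨ε₀, hε₀, hle, α, hα, q, π, T, Φ, hW, hS, r, x, hne⟩ := h εs hεs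
  exact hne (H ε₀ hε₀ hle α hα q π T Φ hW hS r x)

/-- **Kill criterion for K2(a):** Theorem 4.2-level blow-ups from one-shell data on E₂(R)
tables at arbitrarily small scale ratios carrying NO (S_a)-surviving admissible non-trivial DSS
wave refute `BlowupRigidity R a`. [cite: Tao2016AveragedNS, §4 Thm. 4.2; cell vocabulary] -/
theorem not_blowupRigidity_of_waveless_blowups {R a : ℝ}
    (h : ∀ ε : ℝ, 0 < ε → ∃ ε₀ : ℝ, 0 < ε₀ ∧ ε₀ ≤ ε ∧
      ∃ (α : Fin 4 → Fin 4 → Fin 4 → ℤ × ℤ × ℤ → ℝ) (X₀ : Fin 4 → ℝ),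
        InTableClass R α ∧ NoGlobalCascade ε₀ α X₀ ∧
          ∀ (q : ℕ) (π : Equiv.Perm (Fin q)) (T : ℝ) (Φ : Fin q → ℝ → Em 4),
            IsDSSWave ε₀ α π T Φ → Surviving a ε₀ T → ∀ r x, Φ r x = 0) :
    ¬ BlowupRigidity R a := by
  rintro ⟨εs, hεs, H⟩
  obtain ⟨ε₀, hε₀, hle, α, X₀, hα, hNG, hnone⟩ := h εs hεs
  obtain ⟨q, π, T, Φ, hW, hS, r, x, hne⟩ := H ε₀ hε₀ hle α X₀ hα hNG
  exact hne (hnone q π T Φ hW hS r x)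

/-- **Kill criterion for the target predicate:** Theorem 4.2-level blow-ups from one-shell data
on E₂(R) tables at arbitrarily small scale ratios refute `NoRobustBlowupBelow R`.
[cite: Tao2016AveragedNS, §4 Thm. 4.2; cell vocabulary] -/
theorem not_noRobustBlowupBelow_of_persistent_blowups {R : ℝ}
    (h : ∀ ε : ℝ, 0 < ε → ∃ ε₀ : ℝ, 0 < ε₀ ∧ ε₀ ≤ ε ∧
      ∃ (α : Fin 4 → Fin 4 → Fin 4 → ℤ × ℤ × ℤ → ℝ) (X₀ : Fin 4 → ℝ),
        InTableClass R α ∧ NoGlobalCascade ε₀ α X₀) :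
    ¬ NoRobustBlowupBelow R := by
  rintro ⟨εR, hεR, H⟩
  obtain ⟨ε₀, hε₀, hle, α, X₀, hα, hNG⟩ := h εR hεR
  exact H ε₀ hε₀ hle α X₀ hα hNG

end SpreadAndKill

/-! ### The κ-normal form of Theorem 4.2-level blow-up

`NoGlobalCascade ε₀ α X₀` quantifies over implied constants `K₁, K₂ ≥ 0` and all sufficiently
large initial shells `n₀`.  The exact lattice is SHIFT-COVARIANT: moving the datum up by `d` shells
and speeding the clock up by `λ^{5d/2}` maps families obeying (4.5)–(4.11) to such families, with
the defect allowances (4.8)/(4.10) (which carry `λ^{2n}` against the `λ^{5n/2}` of the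
nonlinearity) multiplied by `λ^{-d/2}`.  With monotonicity in `(K₁, K₂)` this collapses the
bookkeeping to `NoGlobalCascade ε₀ α X₀ ↔ ∃ κ > 0, ¬ HasGlobal ε₀ α κ κ 0 X₀`. -/

section NormalForm

variable {m : ℕ}

/-- The conclusions of Lemma 4.1 are monotone in the defect constants.
[cite: Tao2016AveragedNS, §4 Lemma 4.1 (4.8), (4.10)] -/
theorem cascadeFrom_mono_K {ε₀ : ℝ} {α : Fin m → Fin m → Fin m → ℤ × ℤ × ℤ → ℝ}
    {K₁ K₂ K₁' K₂' : ℝ} {n₀ : ℤ} {X₀ : Fin m → ℝ} {X E : Fin m → ℤ → ℝ → ℝ} (hε : 0 ≤ ε₀)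
    (h : CascadeODESolutionFrom ε₀ α K₁ K₂ n₀ X₀ X E) (h₁ : K₁ ≤ K₁') (h₂ : K₂ ≤ K₂') :
    CascadeODESolutionFrom ε₀ α K₁' K₂' n₀ X₀ X E where
  contDiffOn_X := h.contDiffOn_X
  contDiffOn_E := h.contDiffOn_E
  nonneg_E := h.nonneg_E
  apriori_X := h.apriori_X
  apriori_E := h.apriori_E
  init_E := h.init_E
  init_X := h.init_X
  motion i n t ht := by
    have hnn : 0 ≤ (1 + ε₀) ^ ((2 : ℝ) * n) * Real.sqrt (E i n t) :=
      mul_nonneg (Real.rpow_nonneg (by linarith) _) (Real.sqrt_nonneg _)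
    refine (h.motion i n t ht).trans ?_
    rw [mul_assoc, mul_assoc]
    exact mul_le_mul_of_nonneg_right h₁ hnn
  energy := h.energy
  defect_lower := h.defect_lower
  defect_upper i n t ht := by
    have hI : 0 ≤ ∫ s in (0 : ℝ)..t, E i n s :=
      intervalIntegral.integral_nonneg ht fun s hs => h.nonneg_E i n s hs.1
    have hnn : 0 ≤ (1 + ε₀) ^ ((2 : ℝ) * n) * ∫ s in (0 : ℝ)..t, E i n s :=
      mul_nonneg (Real.rpow_nonneg (by linarith) _) hI
    refine (h.defect_upper i n t ht).trans ?_
    rw [mul_assoc, mul_assoc]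
    exact add_le_add le_rfl (mul_le_mul_of_nonneg_right h₂ hnn)
  noLow_X := h.noLow_X
  noLow_E := h.noLow_E

/-- `HasGlobal` is monotone in the defect constants. [cite: Tao2016AveragedNS, §4 Lemma 4.1 (4.8), (4.10)] -/
theorem hasGlobal_mono {ε₀ : ℝ} {α : Fin m → Fin m → Fin m → ℤ × ℤ × ℤ → ℝ}
    {K₁ K₂ K₁' K₂' : ℝ} {n₀ : ℤ} {X₀ : Fin m → ℝ} (hε : 0 ≤ ε₀)
    (h : HasGlobal ε₀ α K₁ K₂ n₀ X₀) (h₁ : K₁ ≤ K₁') (h₂ : K₂ ≤ K₂') :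
    HasGlobal ε₀ α K₁' K₂' n₀ X₀ := by
  obtain ⟨X, E, hXE⟩ := h
  exact ⟨X, E, cascadeFrom_mono_K hε hXE h₁ h₂⟩

/-- Chain rule for a positive linear time change within `[0, ∞)`.
[cite: Tao2016AveragedNS, §4 Lemma 4.1 (i); auxiliary] -/
theorem derivWithin_comp_mul_Ici {f : ℝ → ℝ} {c τ : ℝ} (hf : ContDiffOn ℝ 1 f (Ici 0))
    (hc : 0 < c) (hτ : 0 ≤ τ) :
    derivWithin (fun t => f (c * t)) (Ici 0) τ = c * derivWithin f (Ici 0) (c * τ) := by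
  have hmaps : MapsTo (fun t : ℝ => c * t) (Ici 0) (Ici 0) := fun t ht =>
    mem_Ici.2 (mul_nonneg hc.le (mem_Ici.1 ht))
  have hmem : c * τ ∈ Ici (0 : ℝ) := mem_Ici.2 (mul_nonneg hc.le hτ)
  have h1 : HasDerivWithinAt f (derivWithin f (Ici 0) (c * τ)) (Ici 0) (c * τ) :=
    ((hf.differentiableOn one_ne_zero) (c * τ) hmem).hasDerivWithinAt
  have h2 : HasDerivWithinAt (fun t : ℝ => c * t) c (Ici 0) τ := by
    simpa using ((hasDerivAt_id τ).const_mul c).hasDerivWithinAt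
  have h3 := h1.comp τ h2 hmaps
  rw [show (fun t => f (c * t)) = f ∘ fun t => c * t from rfl,
    h3.derivWithin (uniqueDiffOn_Ici 0 τ (mem_Ici.2 hτ)), mul_comm]

/-- [cite: Tao2016AveragedNS, §4 Lemma 4.1 (i); auxiliary] -/
theorem contDiffOn_comp_mul_Ici {f : ℝ → ℝ} {c : ℝ} (hf : ContDiffOn ℝ 1 f (Ici 0)) (hc : 0 < c) :
    ContDiffOn ℝ 1 (fun t => f (c * t)) (Ici 0) :=
  hf.comp (contDiff_const.mul contDiff_id).contDiffOn fun _ ht =>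
    mem_Ici.2 (mul_nonneg hc.le (mem_Ici.1 ht))

/-- `quadTerm` is shift-covariant: `Q(𝒮_d X)_{i,n}(t) = λ^{-5d/2} Q(X)_{i,n+d}(λ^{-5d/2} t)`.
[cite: Tao2016AveragedNS, §3 (remark after Def. 3.1), §4 (4.4)] -/
theorem quadTerm_shellShift {ε₀ : ℝ} (hε : 0 < ε₀) (α : Fin m → Fin m → Fin m → ℤ × ℤ × ℤ → ℝ)
    (d : ℤ) (X : Fin m → ℤ → ℝ → ℝ) (i : Fin m) (n : ℤ) (t : ℝ) :
    quadTerm ε₀ α (shellShift ε₀ d X) i n t =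
      (1 + ε₀) ^ (-(5 : ℝ) / 2 * d) *
        quadTerm ε₀ α X i (n + d) ((1 + ε₀) ^ (-(5 : ℝ) / 2 * d) * t) := by
  have hB : 0 < 1 + ε₀ := by linarith
  simp only [quadTerm, shellShift, Finset.mul_sum]
  refine Finset.sum_congr rfl fun i₁ _ => Finset.sum_congr rfl fun i₂ _ =>
    Finset.sum_congr rfl fun μ _ => ?_
  have hexp : (1 + ε₀) ^ ((5 : ℝ) * ((n : ℝ) - (μ.2.2 : ℝ)) / 2) =
      (1 + ε₀) ^ (-(5 : ℝ) / 2 * d) *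
        (1 + ε₀) ^ ((5 : ℝ) * (((n + d : ℤ) : ℝ) - (μ.2.2 : ℝ)) / 2) := by
    rw [← Real.rpow_add hB]; push_cast; ring_nf
  have hidx1 : n - μ.2.2 + μ.1 + d = n + d - μ.2.2 + μ.1 := by ring
  have hidx2 : n - μ.2.2 + μ.2.1 + d = n + d - μ.2.2 + μ.2.1 := by ring
  rw [hexp, hidx1, hidx2]; ring

/-- [cite: Tao2016AveragedNS, §4 (4.8); auxiliary] -/
theorem shift_exponent_two {ε₀ : ℝ} (hε : 0 < ε₀) (d n : ℤ) :
    (1 + ε₀) ^ (-(5 : ℝ) / 2 * d) * (1 + ε₀) ^ ((2 : ℝ) * ((n + d : ℤ) : ℝ)) =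
      (1 + ε₀) ^ (-(1 : ℝ) / 2 * d) * (1 + ε₀) ^ ((2 : ℝ) * (n : ℝ)) := by
  have hB : 0 < 1 + ε₀ := by linarith
  rw [← Real.rpow_add hB, ← Real.rpow_add hB]; push_cast; ring_nf

/-- [cite: Tao2016AveragedNS, §4 (4.5); auxiliary] -/
theorem shift_weight_ten {ε₀ : ℝ} (hε : 0 < ε₀) (d n : ℤ) :
    1 + (1 + ε₀) ^ ((10 : ℝ) * (n : ℝ)) ≤
      (1 + (1 + ε₀) ^ ((10 : ℝ) * (-(d : ℝ)))) *
        (1 + (1 + ε₀) ^ ((10 : ℝ) * ((n + d : ℤ) : ℝ))) := by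
  have hB : 0 < 1 + ε₀ := by linarith
  have e : (1 + ε₀) ^ ((10 : ℝ) * (-(d : ℝ))) * (1 + ε₀) ^ ((10 : ℝ) * ((n + d : ℤ) : ℝ)) =
      (1 + ε₀) ^ ((10 : ℝ) * (n : ℝ)) := by
    rw [← Real.rpow_add hB]; push_cast; ring_nf
  nlinarith [Real.rpow_nonneg hB.le ((10 : ℝ) * (-(d : ℝ))),
    Real.rpow_nonneg hB.le ((10 : ℝ) * ((n + d : ℤ) : ℝ)), e]

/-- **SHELL-SHIFT COVARIANCE.**  A global family obeying (4.5)–(4.11) from `X₀` at shell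
`n₀ + d` with defect constants `(K₁, K₂)` yields, by `𝒮_d`, one from `X₀` at shell `n₀` with
constants `(K₁ λ^{-d/2}, K₂ λ^{-d/2})` — for every integer `d`.
[cite: Tao2016AveragedNS, §3 (dyadic scale invariance), §4 Lemma 4.1 (4.5)–(4.11)] -/
theorem cascadeFrom_shellShift {ε₀ : ℝ} (hε : 0 < ε₀)
    {α : Fin m → Fin m → Fin m → ℤ × ℤ × ℤ → ℝ} {K₁ K₂ : ℝ} {n₀ : ℤ} (d : ℤ) {X₀ : Fin m → ℝ}
    {X E : Fin m → ℤ → ℝ → ℝ} (h : CascadeODESolutionFrom ε₀ α K₁ K₂ (n₀ + d) X₀ X E) :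
    CascadeODESolutionFrom ε₀ α (K₁ * (1 + ε₀) ^ (-(1 : ℝ) / 2 * d))
      (K₂ * (1 + ε₀) ^ (-(1 : ℝ) / 2 * d)) n₀ X₀ (shellShift ε₀ d X) (shellShift ε₀ d E) := by
  have hB : 0 < 1 + ε₀ := by linarith
  set c : ℝ := (1 + ε₀) ^ (-(5 : ℝ) / 2 * d) with hc_def
  have hc : 0 < c := Real.rpow_pos_of_pos hB _
  have hct : ∀ {t : ℝ}, 0 ≤ t → 0 ≤ c * t := fun ht => mul_nonneg hc.le ht
  exact
  { contDiffOn_X := fun i n => contDiffOn_comp_mul_Ici (h.contDiffOn_X i (n + d)) hc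
    contDiffOn_E := fun i n => contDiffOn_comp_mul_Ici (h.contDiffOn_E i (n + d)) hc
    nonneg_E := fun i n t ht => h.nonneg_E i (n + d) (c * t) (hct ht)
    apriori_X := by
      intro T hT
      obtain ⟨M, hM⟩ := h.apriori_X (c * T) (mul_pos hc hT)
      refine ⟨(1 + (1 + ε₀) ^ ((10 : ℝ) * (-(d : ℝ)))) * M, fun t ht i n => ?_⟩
      have hmem : c * t ∈ Icc 0 (c * T) := ⟨hct ht.1, mul_le_mul_of_nonneg_left ht.2 hc.le⟩
      have hb := hM (c * t) hmem i (n + d)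
      have hw := shift_weight_ten hε d n
      have hpos : 0 ≤ 1 + (1 + ε₀) ^ ((10 : ℝ) * (-(d : ℝ))) :=
        add_nonneg zero_le_one (Real.rpow_nonneg hB.le _)
      calc (1 + (1 + ε₀) ^ ((10 : ℝ) * (n : ℝ))) * |shellShift ε₀ d X i n t|
          ≤ (1 + (1 + ε₀) ^ ((10 : ℝ) * (-(d : ℝ)))) *
              ((1 + (1 + ε₀) ^ ((10 : ℝ) * ((n + d : ℤ) : ℝ))) * |X i (n + d) (c * t)|) := by
            rw [← mul_assoc]
            exact mul_le_mul_of_nonneg_right hw (abs_nonneg _)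
        _ ≤ (1 + (1 + ε₀) ^ ((10 : ℝ) * (-(d : ℝ)))) * M := mul_le_mul_of_nonneg_left hb hpos
    apriori_E := by
      intro T hT
      obtain ⟨M, hM⟩ := h.apriori_E (c * T) (mul_pos hc hT)
      refine ⟨(1 + (1 + ε₀) ^ ((10 : ℝ) * (-(d : ℝ)))) * M, fun t ht i n => ?_⟩
      have hmem : c * t ∈ Icc 0 (c * T) := ⟨hct ht.1, mul_le_mul_of_nonneg_left ht.2 hc.le⟩
      have hb := hM (c * t) hmem i (n + d)
      have hw := shift_weight_ten hε d n
      have hpos : 0 ≤ 1 + (1 + ε₀) ^ ((10 : ℝ) * (-(d : ℝ))) :=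
        add_nonneg zero_le_one (Real.rpow_nonneg hB.le _)
      calc (1 + (1 + ε₀) ^ ((10 : ℝ) * (n : ℝ))) * Real.sqrt (shellShift ε₀ d E i n t)
          ≤ (1 + (1 + ε₀) ^ ((10 : ℝ) * (-(d : ℝ)))) *
              ((1 + (1 + ε₀) ^ ((10 : ℝ) * ((n + d : ℤ) : ℝ))) *
                Real.sqrt (E i (n + d) (c * t))) := by
            rw [← mul_assoc]
            exact mul_le_mul_of_nonneg_right hw (Real.sqrt_nonneg _)
        _ ≤ (1 + (1 + ε₀) ^ ((10 : ℝ) * (-(d : ℝ)))) * M := mul_le_mul_of_nonneg_left hb hpos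
    init_E := fun i n => by simp only [shellShift, mul_zero]; exact h.init_E i (n + d)
    init_X := fun i n => by
      simp only [shellShift, mul_zero, h.init_X i (n + d), add_left_inj]
    motion := by
      intro i n t ht
      have hD : derivWithin (shellShift ε₀ d X i n) (Ici 0) t =
          c * derivWithin (X i (n + d)) (Ici 0) (c * t) :=
        derivWithin_comp_mul_Ici (h.contDiffOn_X i (n + d)) hc ht
      rw [hD, quadTerm_shellShift hε, ← hc_def, ← mul_sub, abs_mul, abs_of_pos hc]
      calc c * |derivWithin (X i (n + d)) (Ici 0) (c * t) - quadTerm ε₀ α X i (n + d) (c * t)|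
          ≤ c * (K₁ * (1 + ε₀) ^ ((2 : ℝ) * ((n + d : ℤ) : ℝ)) *
              Real.sqrt (E i (n + d) (c * t))) :=
            mul_le_mul_of_nonneg_left (h.motion i (n + d) (c * t) (hct ht)) hc.le
        _ = K₁ * (1 + ε₀) ^ (-(1 : ℝ) / 2 * d) * (1 + ε₀) ^ ((2 : ℝ) * (n : ℝ)) *
              Real.sqrt (shellShift ε₀ d E i n t) := by
            rw [show shellShift ε₀ d E i n t = E i (n + d) (c * t) from rfl,
              show c * (K₁ * (1 + ε₀) ^ ((2 : ℝ) * ((n + d : ℤ) : ℝ)) *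
                  Real.sqrt (E i (n + d) (c * t))) =
                K₁ * (c * (1 + ε₀) ^ ((2 : ℝ) * ((n + d : ℤ) : ℝ))) *
                  Real.sqrt (E i (n + d) (c * t)) by ring,
              hc_def, shift_exponent_two hε d n]
            ring
    energy := by
      intro i n t ht
      have hD : derivWithin (shellShift ε₀ d E i n) (Ici 0) t =
          c * derivWithin (E i (n + d)) (Ici 0) (c * t) :=
        derivWithin_comp_mul_Ici (h.contDiffOn_E i (n + d)) hc ht
      rw [hD, quadTerm_shellShift hε, ← hc_def]
      have := h.energy i (n + d) (c * t) (hct ht)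
      calc c * derivWithin (E i (n + d)) (Ici 0) (c * t)
          ≤ c * (quadTerm ε₀ α X i (n + d) (c * t) * X i (n + d) (c * t)) :=
            mul_le_mul_of_nonneg_left this hc.le
        _ = c * quadTerm ε₀ α X i (n + d) (c * t) * shellShift ε₀ d X i n t := by
            rw [show shellShift ε₀ d X i n t = X i (n + d) (c * t) from rfl]; ring
    defect_lower := fun i n t ht => h.defect_lower i (n + d) (c * t) (hct ht)
    defect_upper := by
      intro i n t ht
      have hint : ∫ s in (0 : ℝ)..c * t, E i (n + d) s =
          c * ∫ σ in (0 : ℝ)..t, shellShift ε₀ d E i n σ := by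
        have h1 := intervalIntegral.integral_comp_mul_left (a := 0) (b := t) (E i (n + d)) hc.ne'
        rw [mul_zero, smul_eq_mul] at h1
        simp only [shellShift]
        rw [h1, ← mul_assoc, mul_inv_cancel₀ hc.ne', one_mul]
      have hb := h.defect_upper i (n + d) (c * t) (hct ht)
      rw [hint] at hb
      calc shellShift ε₀ d E i n t = E i (n + d) (c * t) := rfl
        _ ≤ _ := hb
        _ = 1 / 2 * shellShift ε₀ d X i n t ^ 2 +
              K₂ * (1 + ε₀) ^ (-(1 : ℝ) / 2 * d) * (1 + ε₀) ^ ((2 : ℝ) * (n : ℝ)) *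
                ∫ s in (0 : ℝ)..t, shellShift ε₀ d E i n s := by
            rw [show shellShift ε₀ d X i n t = X i (n + d) (c * t) from rfl,
              show K₂ * (1 + ε₀) ^ ((2 : ℝ) * ((n + d : ℤ) : ℝ)) *
                  (c * ∫ σ in (0 : ℝ)..t, shellShift ε₀ d E i n σ) =
                K₂ * (c * (1 + ε₀) ^ ((2 : ℝ) * ((n + d : ℤ) : ℝ))) *
                  ∫ σ in (0 : ℝ)..t, shellShift ε₀ d E i n σ by ring,
              hc_def, shift_exponent_two hε d n]
            ring
    noLow_X := fun i n t hn ht => h.noLow_X i (n + d) (c * t) (by omega) (hct ht)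
    noLow_E := fun i n t hn ht => h.noLow_E i (n + d) (c * t) (by omega) (hct ht) }

/-- [cite: Tao2016AveragedNS, §3 (dyadic scale invariance), §4 Lemma 4.1] -/
theorem hasGlobal_shellShift {ε₀ : ℝ} (hε : 0 < ε₀)
    {α : Fin m → Fin m → Fin m → ℤ × ℤ × ℤ → ℝ} {K₁ K₂ : ℝ} {n₀ : ℤ} (d : ℤ) {X₀ : Fin m → ℝ}
    (h : HasGlobal ε₀ α K₁ K₂ (n₀ + d) X₀) :
    HasGlobal ε₀ α (K₁ * (1 + ε₀) ^ (-(1 : ℝ) / 2 * d)) (K₂ * (1 + ε₀) ^ (-(1 : ℝ) / 2 * d))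
      n₀ X₀ := by
  obtain ⟨X, E, hXE⟩ := h
  exact ⟨_, _, cascadeFrom_shellShift hε d hXE⟩

/-- **THEOREM 4.2-LEVEL BLOW-UP IN NORMAL FORM**:
`NoGlobalCascade ε₀ α X₀ ↔ ∃ κ > 0, ¬ HasGlobal ε₀ α κ κ 0 X₀` — "for SOME positive defect budget
`κ` there is no global κ-pseudo-solution from the datum at shell `0`".
[cite: Tao2016AveragedNS, §4 Thm. 4.2 with Lemma 4.1 (4.5)–(4.11)] -/
theorem noGlobalCascade_iff_kappa {ε₀ : ℝ} (hε : 0 < ε₀)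
    {α : Fin m → Fin m → Fin m → ℤ × ℤ × ℤ → ℝ} {X₀ : Fin m → ℝ} :
    NoGlobalCascade ε₀ α X₀ ↔ ∃ κ : ℝ, 0 < κ ∧ ¬ HasGlobal ε₀ α κ κ 0 X₀ := by
  have hB : 0 < 1 + ε₀ := by linarith
  have hB1 : 1 < 1 + ε₀ := by linarith
  constructor
  · intro H
    obtain ⟨N₀, hN₀⟩ := H 1 1 zero_le_one zero_le_one
    set n : ℤ := max N₀ 0 with hn_def
    refine ⟨(1 + ε₀) ^ (-(1 : ℝ) / 2 * n), Real.rpow_pos_of_pos hB _, fun hG => ?_⟩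
    have hG' : HasGlobal ε₀ α ((1 + ε₀) ^ (-(1 : ℝ) / 2 * n)) ((1 + ε₀) ^ (-(1 : ℝ) / 2 * n))
        (n + -n) X₀ := by rwa [add_neg_cancel]
    have hS := hasGlobal_shellShift hε (-n) hG'
    have hone : (1 + ε₀) ^ (-(1 : ℝ) / 2 * n) * (1 + ε₀) ^ (-(1 : ℝ) / 2 * ((-n : ℤ) : ℝ)) = 1 := by
      rw [← Real.rpow_add hB]; push_cast; ring_nf; exact Real.rpow_zero _
    rw [hone] at hS
    exact hN₀ n (le_max_left _ _) hS
  · rintro ⟨κ, hκ, hno⟩ K₁ K₂ hK₁ hK₂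
    set s : ℝ := (1 + ε₀) ^ (-(1 : ℝ) / 2) with hs_def
    have hs0 : 0 < s := Real.rpow_pos_of_pos hB _
    have hs1 : s < 1 := Real.rpow_lt_one_of_one_lt_of_neg hB1 (by norm_num)
    have hKm : 0 < max K₁ K₂ + 1 := by positivity
    obtain ⟨N, hN⟩ := exists_pow_lt_of_lt_one (div_pos hκ hKm) hs1
    refine ⟨(N : ℤ), fun n₀ hn₀ hG => hno ?_⟩
    have h0 : 0 ≤ n₀ := le_trans (by exact_mod_cast Nat.zero_le N) hn₀
    have hG' : HasGlobal ε₀ α K₁ K₂ (0 + n₀) X₀ := by rwa [zero_add]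
    have hS := hasGlobal_shellShift hε n₀ hG'
    -- the shift factor is `s ^ n₀.toNat ≤ s ^ N`
    have hk : ((n₀ : ℤ) : ℝ) = ((n₀.toNat : ℕ) : ℝ) := by
      have := Int.toNat_of_nonneg h0
      exact_mod_cast this.symm
    have hfac : (1 + ε₀) ^ (-(1 : ℝ) / 2 * n₀) = s ^ n₀.toNat := by
      rw [hk, Real.rpow_mul hB.le, Real.rpow_natCast]
    have hNk : N ≤ n₀.toNat := by
      have := Int.toNat_of_nonneg h0; omega
    have hpow : s ^ n₀.toNat ≤ s ^ N := pow_le_pow_of_le_one hs0.le hs1.le hNk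
    have hsN : (max K₁ K₂ + 1) * s ^ N ≤ κ := by
      have := (lt_div_iff₀ hKm).1 hN
      linarith [mul_comm (s ^ N) (max K₁ K₂ + 1)]
    have hbound : ∀ {K : ℝ}, 0 ≤ K → K ≤ max K₁ K₂ → K * (1 + ε₀) ^ (-(1 : ℝ) / 2 * n₀) ≤ κ := by
      intro K hK hKle
      rw [hfac]
      have hsn : 0 ≤ s ^ n₀.toNat := pow_nonneg hs0.le _
      calc K * s ^ n₀.toNat ≤ (max K₁ K₂ + 1) * s ^ n₀.toNat :=
            mul_le_mul_of_nonneg_right (by linarith) hsn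
        _ ≤ (max K₁ K₂ + 1) * s ^ N := mul_le_mul_of_nonneg_left hpow hKm.le
        _ ≤ κ := hsN
    exact hasGlobal_mono hε.le hS (hbound hK₁ (le_max_left _ _)) (hbound hK₂ (le_max_right _ _))

/-- **The target in normal form ⇔ UNIFORM κ-STALLABILITY**: below `ε_R`, every one-shell datum on
every E₂(R) table admits, for EVERY defect budget `κ > 0`, a global κ-pseudo-solution from shell
`0`. [cite: Tao2016AveragedNS, §4 Thm. 4.2 with Lemma 4.1; cell vocabulary] -/
theorem noRobustBlowupBelow_iff_stallable {R : ℝ} :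
    NoRobustBlowupBelow R ↔
      ∃ εR : ℝ, 0 < εR ∧ ∀ ε₀ : ℝ, 0 < ε₀ → ε₀ ≤ εR →
        ∀ (α : Fin 4 → Fin 4 → Fin 4 → ℤ × ℤ × ℤ → ℝ) (X₀ : Fin 4 → ℝ), InTableClass R α →
          ∀ κ : ℝ, 0 < κ → HasGlobal ε₀ α κ κ 0 X₀ := by
  constructor
  · rintro ⟨εR, hεR, H'⟩
    refine ⟨εR, hεR, fun ε₀ hε₀ hle α X₀ hα κ hκ => ?_⟩
    by_contra hno
    exact H' ε₀ hε₀ hle α X₀ hα ((noGlobalCascade_iff_kappa hε₀).2 ⟨κ, hκ, hno⟩)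
  · rintro ⟨εR, hεR, H'⟩
    refine ⟨εR, hεR, fun ε₀ hε₀ hle α X₀ hα hNG => ?_⟩
    obtain ⟨κ, hκ, hno⟩ := (noGlobalCascade_iff_kappa hε₀).1 hNG
    exact hno (H' ε₀ hε₀ hle α X₀ hα κ hκ)

end NormalForm

/-! ### Viscous pseudo-solutions: the NS-scaled viscous lattice and uniform viscous stall

The exact solution of the VISCOUS lattice `∂ₜX_{i,n} = Q(X)_{i,n} − ν(1+ε₀)^{2n} X_{i,n}` (the
dissipation term of the remark after (4.11), any `ν ≥ 0`) with `E := ½X²` obeys (4.5)–(4.11) with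
defect constants `(K₁, K₂) = (ν√2, 0)` — provided it is globally regular in the a-priori sense
(4.5). -/

section Viscous

variable {m : ℕ}

/-- `√(x²/2) = |x|/√2`.  The same statement is proved summit-side as
`Summit.NavierStokesRegularity.NavierStokesRegularity.Theorems.CircuitTrace.Negative.sqrt_half_sq`
(a `Summits/` file, not importable into `Literature/`), hence restated.
[cite: Tao2016AveragedNS, §4 (4.9); auxiliary] -/
theorem sqrt_half_sq (x : ℝ) : Real.sqrt (1 / 2 * x ^ 2) = |x| / Real.sqrt 2 := by
  rw [show (1 : ℝ) / 2 * x ^ 2 = x ^ 2 / 2 by ring, Real.sqrt_div (sq_nonneg x),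
    Real.sqrt_sq_eq_abs]

/-- [cite: Tao2016AveragedNS, §4 (4.9); auxiliary] -/
theorem derivWithin_half_sq_Ici {f : ℝ → ℝ} {τ : ℝ} (hf : ContDiffOn ℝ 1 f (Ici 0)) (hτ : 0 ≤ τ) :
    derivWithin (fun t => 1 / 2 * f t ^ 2) (Ici 0) τ = f τ * derivWithin f (Ici 0) τ := by
  have h1 : HasDerivWithinAt f (derivWithin f (Ici 0) τ) (Ici 0) τ :=
    ((hf.differentiableOn one_ne_zero) τ (mem_Ici.2 hτ)).hasDerivWithinAt
  have h2 : HasDerivWithinAt (fun t => 1 / 2 * f t ^ 2)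
      (1 / 2 * (derivWithin f (Ici 0) τ * f τ + f τ * derivWithin f (Ici 0) τ)) (Ici 0) τ := by
    have := (h1.mul h1).const_mul (1 / 2 : ℝ)
    simpa [pow_two] using this
  rw [h2.derivWithin (uniqueDiffOn_Ici 0 τ (mem_Ici.2 hτ))]
  ring

/-- **A global regular viscous solution is a `(ν√2, 0)`-pseudo-solution from shell `0`.**
[cite: Tao2016AveragedNS, §4 Lemma 4.1 (4.5)–(4.11) and the remark after (4.11); cell vocabulary] -/
theorem hasGlobal_of_viscousGlobal {ε₀ ν : ℝ} (hε : 0 < ε₀) (hν : 0 ≤ ν)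
    {α : Fin m → Fin m → Fin m → ℤ × ℤ × ℤ → ℝ} {X₀ : Fin m → ℝ} {X : Fin m → ℤ → ℝ → ℝ}
    (h : ViscousGlobal ε₀ ν α X₀ X) : HasGlobal ε₀ α (ν * Real.sqrt 2) 0 0 X₀ := by
  have hB : 0 < 1 + ε₀ := by linarith
  have h2 : 0 < Real.sqrt 2 := Real.sqrt_pos.2 two_pos
  have h2' : 1 ≤ Real.sqrt 2 := by
    rw [show (1 : ℝ) = Real.sqrt 1 from Real.sqrt_one.symm]
    exact Real.sqrt_le_sqrt (by norm_num)
  refine ⟨X, fun i n t => 1 / 2 * X i n t ^ 2, ?_⟩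
  exact
  { contDiffOn_X := h.contDiffOn
    contDiffOn_E := fun i n => contDiffOn_const.mul ((h.contDiffOn i n).pow 2)
    nonneg_E := fun i n t _ => by positivity
    apriori_X := h.apriori
    apriori_E := by
      intro T hT
      obtain ⟨M, hM⟩ := h.apriori T hT
      refine ⟨M, fun t ht i n => ?_⟩
      have hw : 0 ≤ 1 + (1 + ε₀) ^ ((10 : ℝ) * n) :=
        add_nonneg zero_le_one (Real.rpow_nonneg hB.le _)
      calc (1 + (1 + ε₀) ^ ((10 : ℝ) * n)) * Real.sqrt (1 / 2 * X i n t ^ 2)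
          = (1 + (1 + ε₀) ^ ((10 : ℝ) * n)) * (|X i n t| / Real.sqrt 2) := by rw [sqrt_half_sq]
        _ ≤ (1 + (1 + ε₀) ^ ((10 : ℝ) * n)) * |X i n t| :=
            mul_le_mul_of_nonneg_left (div_le_self (abs_nonneg _) h2') hw
        _ ≤ M := hM t ht i n
    init_E := fun i n => rfl
    init_X := h.init
    motion := by
      intro i n t ht
      rw [h.motion i n t ht, sqrt_half_sq,
        show quadTerm ε₀ α X i n t - ν * (1 + ε₀) ^ ((2 : ℝ) * n) * X i n t - quadTerm ε₀ α X i n t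
            = -(ν * (1 + ε₀) ^ ((2 : ℝ) * n) * X i n t) by ring,
        abs_neg, abs_mul, abs_mul, abs_of_nonneg hν, abs_of_nonneg (Real.rpow_nonneg hB.le _)]
      apply le_of_eq
      field_simp
    energy := by
      intro i n t ht
      rw [derivWithin_half_sq_Ici (h.contDiffOn i n) ht, h.motion i n t ht]
      have : 0 ≤ ν * (1 + ε₀) ^ ((2 : ℝ) * n) * X i n t ^ 2 :=
        mul_nonneg (mul_nonneg hν (Real.rpow_nonneg hB.le _)) (sq_nonneg _)
      nlinarith [this]
    defect_lower := fun i n t _ => le_rfl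
    defect_upper := fun i n t _ => by simp
    noLow_X := h.noLow
    noLow_E := fun i n t hn ht => by simp [h.noLow i n t hn ht] }

/-- **Uniform viscous stall at spread `R` = `ViscousStall R`**: below a threshold `ε_R`, for
every E₂(R) table (`m = 4`), every one-shell datum and every viscosity `ν > 0`, the NS-scaled
viscous lattice from the datum at shell `0` has a global regular solution.  A predicate on `R`
(antitone); nothing is asserted (global well-posedness of the viscous lattice is part of what it
asks). [cite: Tao2016AveragedNS, §4 (remark after (4.11)), Thm. 4.2 (statement shape); cell vocabulary] -/
def ViscousStall (R : ℝ) : Prop :=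
  ∃ εR : ℝ, 0 < εR ∧ ∀ ε₀ : ℝ, 0 < ε₀ → ε₀ ≤ εR →
    ∀ (α : Fin 4 → Fin 4 → Fin 4 → ℤ × ℤ × ℤ → ℝ) (X₀ : Fin 4 → ℝ), InTableClass R α →
      ∀ ν : ℝ, 0 < ν → ∃ X : Fin 4 → ℤ → ℝ → ℝ, ViscousGlobal ε₀ ν α X₀ X

/-- **`ViscousStall R ⇒ NoRobustBlowupBelow R`** (via the κ-normal form).
[cite: Tao2016AveragedNS, §4 Thm. 4.2 with Lemma 4.1; cell vocabulary] -/
theorem noRobustBlowupBelow_of_viscousStall {R : ℝ} (h : ViscousStall R) :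
    NoRobustBlowupBelow R :=
  noRobustBlowupBelow_iff_stallable.2 <| by
    obtain ⟨εR, hεR, H⟩ := h
    refine ⟨εR, hεR, fun ε₀ hε₀ hle α X₀ hα κ hκ => ?_⟩
    have h2 : 0 < Real.sqrt 2 := Real.sqrt_pos.2 two_pos
    obtain ⟨X, hX⟩ := H ε₀ hε₀ hle α X₀ hα (κ / Real.sqrt 2) (div_pos hκ h2)
    have hG := hasGlobal_of_viscousGlobal hε₀ (div_pos hκ h2).le hX
    rw [div_mul_cancel₀ κ h2.ne'] at hG
    exact hasGlobal_mono hε₀.le hG le_rfl hκ.le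

/-- `ViscousStall` is antitone in `R`. [cite: Tao2016AveragedNS, §6.1; cell vocabulary] -/
theorem ViscousStall.of_le_spread {R R' : ℝ} (hR : 0 < R) (hRR' : R ≤ R') (h : ViscousStall R') :
    ViscousStall R := by
  obtain ⟨εR, hεR, H⟩ := h
  exact ⟨εR, hεR, fun ε₀ hε₀ hle α X₀ hα => H ε₀ hε₀ hle α X₀ (hα.mono hR hRR')⟩

/-- **Kill criterion for `ViscousStall R`:** at arbitrarily small scale ratios some E₂(R) table,
datum and positive viscosity admit NO global regular viscous solution.
[cite: Tao2016AveragedNS, §4; cell vocabulary] -/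
theorem not_viscousStall_of_viscous_blowups {R : ℝ}
    (h : ∀ ε : ℝ, 0 < ε → ∃ ε₀ : ℝ, 0 < ε₀ ∧ ε₀ ≤ ε ∧
      ∃ (α : Fin 4 → Fin 4 → Fin 4 → ℤ × ℤ × ℤ → ℝ) (X₀ : Fin 4 → ℝ), InTableClass R α ∧
        ∃ ν : ℝ, 0 < ν ∧ ∀ X : Fin 4 → ℤ → ℝ → ℝ, ¬ ViscousGlobal ε₀ ν α X₀ X) :
    ¬ ViscousStall R := by
  rintro ⟨εR, hεR, H⟩
  obtain ⟨ε₀, hε₀, hle, α, X₀, hα, ν, hν, hnone⟩ := h εR hεR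
  obtain ⟨X, hX⟩ := H ε₀ hε₀ hle α X₀ hα ν hν
  exact hnone X hX

end Viscous

/-! ### The dyadic member of E₂(R)

The Katz–Pavlović / Cheskidov dyadic chain `ȧ_n = λ^{5(n-1)/2} a_{n-1}² − λ^{5n/2} a_n a_{n+1}`
(the `m = 1` case of the cascade system, §4) is a member of the comparable class E₂(R) for every
spread `R ≥ 2`: the `m = 4` table supported on the component triple `(0,0,0)` with pump
coefficient `α_{000,(0,0,1)} = 1` and drain coefficients `α_{000,(1,0,0)} = α_{000,(0,1,0)} = -1/2`
is symmetric (4.2), cancelling (4.3) and `R`-comparable, and its cascade nonlinearity on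
component `0` is exactly the dyadic one (zero on the others). -/

section DyadicMember

/-- [cite: Tao2016AveragedNS, §1.2; cell vocabulary] -/
theorem dyadicTable_of_not {i₁ i₂ i₃ : Fin 4} {μ : ℤ × ℤ × ℤ} (h : ¬ (i₁ = 0 ∧ i₂ = 0 ∧ i₃ = 0)) :
    dyadicTable i₁ i₂ i₃ μ = 0 := by
  simp [dyadicTable, h]

/-- The table takes only the values `0`, `1`, `-1/2`. [cite: Tao2016AveragedNS, §1.2; cell vocabulary] -/
theorem dyadicTable_values (i₁ i₂ i₃ : Fin 4) (μ : ℤ × ℤ × ℤ) :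
    dyadicTable i₁ i₂ i₃ μ = 0 ∨ dyadicTable i₁ i₂ i₃ μ = 1 ∨
      dyadicTable i₁ i₂ i₃ μ = -(1 / 2) := by
  unfold dyadicTable
  split_ifs <;> simp

/-- Symmetry (4.2) of the dyadic table. [cite: Tao2016AveragedNS, §4 (4.2)] -/
theorem dyadicTable_symmetric : IsSymmetricCoeff dyadicTable := by
  intro i₁ i₂ i₃ μ₁ μ₂ μ₃ hμ
  rw [mem_shiftSet_iff] at hμ
  simp only [Prod.mk.injEq] at hμ
  rcases hμ with ⟨rfl, rfl, rfl⟩ | ⟨rfl, rfl, rfl⟩ | ⟨rfl, rfl, rfl⟩ | ⟨rfl, rfl, rfl⟩ <;>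
    by_cases h1 : i₁ = 0 <;> by_cases h2 : i₂ = 0 <;> by_cases h3 : i₃ = 0 <;>
      simp [dyadicTable, h1, h2, h3]

/-- Cancellation (4.3) of the dyadic table (energy conservation of the dyadic pair).
[cite: Tao2016AveragedNS, §4 (4.3)] -/
theorem dyadicTable_cancelling : IsCancellingCoeff dyadicTable := by
  intro i₁ i₂ i₃ μ₁ μ₂ μ₃ hμ
  rw [mem_shiftSet_iff] at hμ
  simp only [Prod.mk.injEq] at hμ
  rcases hμ with ⟨rfl, rfl, rfl⟩ | ⟨rfl, rfl, rfl⟩ | ⟨rfl, rfl, rfl⟩ | ⟨rfl, rfl, rfl⟩ <;>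
    by_cases h1 : i₁ = 0 <;> by_cases h2 : i₂ = 0 <;> by_cases h3 : i₃ = 0 <;>
      simp [dyadicTable, h1, h2, h3] <;> norm_num

/-- `R`-comparability of the dyadic table for every spread `R ≥ 2` (the drain coefficients have
modulus `1/2`). [cite: Tao2016AveragedNS, §6.1; cell vocabulary] -/
theorem dyadicTable_comparable {R : ℝ} (hR : 2 ≤ R) : IsComparableCoeff R dyadicTable := by
  intro i₁ i₂ i₃ μ _
  have hRpos : 0 < R := by linarith
  have hhalf : R⁻¹ ≤ 1 / 2 := by
    rw [inv_le_comm₀ hRpos (by norm_num)]; norm_num; exact hR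
  rcases dyadicTable_values i₁ i₂ i₃ μ with h | h | h <;> rw [h]
  · simp
  · refine ⟨by simp, Or.inr ?_⟩
    simp only [abs_one]; linarith
  · refine ⟨by norm_num, Or.inr ?_⟩
    rw [abs_neg, abs_of_pos (by norm_num : (0:ℝ) < 1 / 2)]; exact hhalf

/-- **The dyadic chain is a member of E₂(R) for every `R ≥ 2`.**
[cite: Tao2016AveragedNS, §4 (4.2)–(4.3), §6.1; cell vocabulary] -/
theorem inTableClass_dyadicTable {R : ℝ} (hR : 2 ≤ R) : InTableClass R dyadicTable :=
  ⟨dyadicTable_symmetric, dyadicTable_cancelling, dyadicTable_comparable hR⟩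

/-- Off component `0` the dyadic table drives nothing. [cite: Tao2016AveragedNS, §4 (4.4)] -/
theorem quadTerm_dyadicTable_of_ne (ε₀ : ℝ) (X : Fin 4 → ℤ → ℝ → ℝ) {i : Fin 4} (hi : i ≠ 0)
    (n : ℤ) (t : ℝ) : quadTerm ε₀ dyadicTable X i n t = 0 := by
  unfold quadTerm
  refine Finset.sum_eq_zero fun i₁ _ => Finset.sum_eq_zero fun i₂ _ =>
    Finset.sum_eq_zero fun μ _ => ?_
  have : ¬ (i₁ = 0 ∧ i₂ = 0 ∧ i = 0) := fun h => hi h.2.2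
  simp [dyadicTable_of_not this]

/-- **On component `0` the cascade nonlinearity of the dyadic table is the dyadic one:**
`quadTerm = λ^{5(n-1)/2} X_{0,n-1}² − λ^{5n/2} X_{0,n} X_{0,n+1}`, `λ = 1+ε₀`.
[cite: Tao2016AveragedNS, §1.2 (dyadic model system), §4 (4.4)] -/
theorem quadTerm_dyadicTable_zero (ε₀ : ℝ) (X : Fin 4 → ℤ → ℝ → ℝ) (n : ℤ) (t : ℝ) :
    quadTerm ε₀ dyadicTable X 0 n t =
      (1 + ε₀) ^ ((5 : ℝ) * (n - 1) / 2) * X 0 (n - 1) t ^ 2 -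
        (1 + ε₀) ^ ((5 : ℝ) * n / 2) * (X 0 n t * X 0 (n + 1) t) := by
  unfold quadTerm
  rw [Fintype.sum_eq_single (0 : Fin 4) (fun i₁ hi₁ => Finset.sum_eq_zero fun i₂ _ =>
      Finset.sum_eq_zero fun μ _ => by
        have : ¬ (i₁ = 0 ∧ i₂ = 0 ∧ (0 : Fin 4) = 0) := fun h => hi₁ h.1
        simp [dyadicTable_of_not this])]
  rw [Fintype.sum_eq_single (0 : Fin 4) (fun i₂ hi₂ => Finset.sum_eq_zero fun μ _ => by
        have : ¬ ((0 : Fin 4) = 0 ∧ i₂ = 0 ∧ (0 : Fin 4) = 0) := fun h => hi₂ h.2.1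
        simp [dyadicTable_of_not this])]
  rw [shiftSet, Finset.sum_insert (by decide), Finset.sum_insert (by decide),
    Finset.sum_insert (by decide), Finset.sum_singleton]
  simp only [dyadicTable, and_self, if_true, Prod.mk.injEq]
  norm_num
  ring

/-- K1 restricted to the dyadic member: `NoSurvivingDSS R a` with `R ≥ 2` forbids, below its
threshold, every non-trivial admissible (S_a)-surviving DSS blow-up wave OF THE DYADIC CHAIN at
base `1+ε₀`. [cite: Tao2016AveragedNS, §1.2, §4; cell vocabulary] -/
theorem NoSurvivingDSS.dyadic {R a : ℝ} (h : NoSurvivingDSS R a) (hR : 2 ≤ R) :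
    ∃ εs : ℝ, 0 < εs ∧ ∀ ε₀ : ℝ, 0 < ε₀ → ε₀ ≤ εs →
      ∀ (q : ℕ) (π : Equiv.Perm (Fin q)) (T : ℝ) (Φ : Fin q → ℝ → Em 4),
        IsDSSWave ε₀ dyadicTable π T Φ → Surviving a ε₀ T → ∀ r x, Φ r x = 0 := by
  obtain ⟨εs, hεs, H⟩ := h
  exact ⟨εs, hεs, fun ε₀ hε₀ hle => H ε₀ hε₀ hle dyadicTable (inTableClass_dyadicTable hR)⟩

/-- **Kill criterion, dyadic form:** admissible non-trivial (S_a)-surviving DSS blow-up waves of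
the dyadic chain at arbitrarily small scale ratios refute `NoSurvivingDSS R a` for EVERY `R ≥ 2`.
[cite: Tao2016AveragedNS, §1.2, §4; cell vocabulary] -/
theorem not_noSurvivingDSS_of_dyadic_waves {R a : ℝ} (hR : 2 ≤ R)
    (h : ∀ ε : ℝ, 0 < ε → ∃ ε₀ : ℝ, 0 < ε₀ ∧ ε₀ ≤ ε ∧
      ∃ (q : ℕ) (π : Equiv.Perm (Fin q)) (T : ℝ) (Φ : Fin q → ℝ → Em 4),
        IsDSSWave ε₀ dyadicTable π T Φ ∧ Surviving a ε₀ T ∧ ∃ r x, Φ r x ≠ 0) :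
    ¬ NoSurvivingDSS R a := by
  refine not_noSurvivingDSS_of_persistent_waves fun ε hε => ?_
  obtain ⟨ε₀, hε₀, hle, q, π, T, Φ, hW, hS, hne⟩ := h ε hε
  exact ⟨ε₀, hε₀, hle, dyadicTable, inTableClass_dyadicTable hR, q, π, T, Φ, hW, hS, hne⟩

/-- `ViscousStall R` (`R ≥ 2`) contains, as its dyadic slice, GLOBAL REGULARITY OF THE NS-SCALED
VISCOUS DYADIC CHAIN at every base `1+ε₀ ≤ 1+ε_R`, every viscosity, every one-shell datum.
[cite: Tao2016AveragedNS, §1.2, §4 (remark before Thm. 4.2); cell vocabulary] -/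
theorem ViscousStall.dyadic {R : ℝ} (h : ViscousStall R) (hR : 2 ≤ R) :
    ∃ εv : ℝ, 0 < εv ∧ ∀ ε₀ : ℝ, 0 < ε₀ → ε₀ ≤ εv → ∀ ν : ℝ, 0 < ν →
      ∀ X₀ : Fin 4 → ℝ, ∃ X, ViscousGlobal ε₀ ν dyadicTable X₀ X := by
  obtain ⟨εv, hεv, H⟩ := h
  exact ⟨εv, hεv, fun ε₀ hε₀ hle ν hν X₀ => H ε₀ hε₀ hle dyadicTable X₀
    (inTableClass_dyadicTable hR) ν hν⟩

/-- The target predicate restricted to the dyadic member: `NoRobustBlowupBelow R` (`R ≥ 2`) says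
that below `ε_R` the dyadic chain at base `1+ε₀` does NOT blow up at Theorem 4.2 level from any
one-shell datum. [cite: Tao2016AveragedNS, §1.2, §4 Thm. 4.2 (statement shape); cell vocabulary] -/
theorem NoRobustBlowupBelow.dyadic {R : ℝ} (h : NoRobustBlowupBelow R) (hR : 2 ≤ R) :
    ∃ εR : ℝ, 0 < εR ∧ ∀ ε₀ : ℝ, 0 < ε₀ → ε₀ ≤ εR →
      ∀ X₀ : Fin 4 → ℝ, ¬ NoGlobalCascade ε₀ dyadicTable X₀ := by
  obtain ⟨εR, hεR, H⟩ := h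
  exact ⟨εR, hεR, fun ε₀ hε₀ hle X₀ => H ε₀ hε₀ hle dyadicTable X₀ (inTableClass_dyadicTable hR)⟩

/-- **Kill criterion for the target, dyadic form:** Theorem 4.2-level blow-ups of the dyadic
chain from one-shell data at arbitrarily small scale ratios refute `NoRobustBlowupBelow R` for
every `R ≥ 2`. [cite: Tao2016AveragedNS, §1.2, §4 Thm. 4.2; cell vocabulary] -/
theorem not_noRobustBlowupBelow_of_dyadic_blowups {R : ℝ} (hR : 2 ≤ R)
    (h : ∀ ε : ℝ, 0 < ε → ∃ ε₀ : ℝ, 0 < ε₀ ∧ ε₀ ≤ ε ∧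
      ∃ X₀ : Fin 4 → ℝ, NoGlobalCascade ε₀ dyadicTable X₀) :
    ¬ NoRobustBlowupBelow R := by
  refine not_noRobustBlowupBelow_of_persistent_blowups fun ε hε => ?_
  obtain ⟨ε₀, hε₀, hle, X₀, hNG⟩ := h ε hε
  exact ⟨ε₀, hε₀, hle, dyadicTable, X₀, inTableClass_dyadicTable hR, hNG⟩

end DyadicMember

end TaoCascade

end Literature.Analysis.FluidPDE

end
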